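import Mathlib.Analysis.Calculus.Deriv.MeanValue
import Mathlib.Analysis.Calculus.Deriv.Pow
import Mathlib.Analysis.Calculus.Deriv.Inv
import Mathlib.Order.Filter.AtTopBot.Basic
import HarnessLib

/-!
# Integrating `y' ≤ A yⁿ⁺¹`: the root-free comparison behind the Lu–Doering and Leray-type rates

Analysis/FluidPDE file, the common real-variable core of `ExtremeGrowthBounds.lean`
(`dℰ/dt ≤ C_LD ℰ³`, exponent `n = 2`) and `ExtremeGrowthBlowupRate.lean` (its backward
integration), written once for a general natural exponent `n ≥ 1` and stated WITHOUT roots: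

* `pow_mul_le_pow_of_hasDerivWithinAt_le_pow_succ` — `f > 0` on `[a, b]` with one-sided
  derivatives `f' ≤ A fⁿ⁺¹` ⇒ `f(t)ⁿ (1 − n A f(a)ⁿ (t − a)) ≤ f(a)ⁿ` for every `t ∈ [a, b]`
  (no smallness hypothesis: when the bracket is `≤ 0` the inequality is trivial);
* `pow_le_pow_div_of_hasDerivWithinAt_le_pow_succ` — the majorant form
  `f(t)ⁿ ≤ f(a)ⁿ / (1 − n A f(a)ⁿ (t − a))` while the bracket is positive, i.e.
  `f(t) ≤ f(a) (1 − n A f(a)ⁿ (t − a))^{-1/n}` before `t₀ = a + 1/(n A f(a)ⁿ)`;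
* `one_le_of_not_bddAbove_of_hasDerivWithinAt_le_pow_succ` — backward integration from a
  blow-up time: `f` unbounded on `[a, T)` ⇒ `1 ≤ n A f(a)ⁿ (T − a)`, i.e. the NECESSARY RATE
  `f(a) ≥ (n A (T − a))^{-1/n}`; `one_le_of_tendsto_atTop_of_hasDerivWithinAt_le_pow_succ` is
  the same with the blow-up hypothesis `f → ∞` as `t ↑ T`.

The one-line argument is the same as for `n = 2`: `s ↦ f(s)⁻ⁿ + n A (s − a)` is nondecreasing.

Instances (the dictionary is the docstrings' only physics; the PDE estimates are named facts or
not yet typed): enstrophy of zero-mean Navier–Stokes flows on `T³`, `dℰ/dt ≤ (27/(8π⁴ν³)) ℰ³`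
(Lu–Doering 2008; Ayala–Protas 2017, (2.7)–(2.8)) is `n = 2` and gives back
`ExtremeGrowthBounds.le_div_sqrt_of_hasDerivWithinAt_le_cube` after a square root; the Leray-type
`L^q` rates `d/dt ‖u‖_{L^q} ≤ C_q ‖u‖_{L^q}^{1 + 2q/(q−3)}`, `q > 3` (Leray 1934, §22;
Robinson–Rodrigo–Sadowski 2016, Exercises 11.6–11.7 with (11.21) and the rate (11.18);
Bleitner–Protas 2026, Table 3; Protas 2026 essay, (48)–(50)) have INTEGER `n = 2q/(q − 3)`
exactly at the computed cases `q = 4, 5, 6, 9 ↦ n = 8, 5, 4, 3`, with necessary rate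
`‖u(t)‖_{L^q} ≥ (n C_q (T* − t))^{-1/n}`, `1/n = (q − 3)/(2q)` (Leray's exponent). The last
theorem is the root-free, integer-exponent form of Robinson–Rodrigo–Sadowski's Exercise 11.6
("`Ẋ ≤ c X^θ`, `θ > 1`, `X(t) → ∞` as `t → T` ⇒ `X(t) ≥ κ (T − t)^{-1/(θ−1)}`", `θ = n + 1`) with
the explicit constant `κ^{-n} = n c` and unboundedness in place of divergence.

Deliberately NOT here: the PDE estimates themselves, real (`rpow`) exponents, and the torus
`L^q` norms (no consumer yet).
-/

noncomputable section

open Set Filter Topology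

namespace Literature.Analysis.FluidPDE

section Comparison

/-- **Root-free comparison for `y' ≤ A yⁿ⁺¹`.** If `0 < n`, `a < b`, `f > 0` on `[a, b]` has
one-sided derivatives `f'` within `[a, b]` with `f' ≤ A fⁿ⁺¹`, then for every `t ∈ [a, b]`,
`f(t)ⁿ · (1 − n A f(a)ⁿ (t − a)) ≤ f(a)ⁿ` (the function `f⁻ⁿ + n A (· − a)` is nondecreasing on
`[a, b]`). For `n = 2` this is the integration step (2.7) ⇒ (2.8) of Ayala–Protas 2017; for
`n = 2q/(q−3)`, `A = C_q` it is the integrated Leray `L^q` bound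
`‖u(t)‖_{L^q} ≤ (‖u₀‖_{L^q}^{-n} − n C_q t)^{-1/n}` of the Protas 2026 essay, eq. (49), raised to
the power `n` and cleared of the root and the denominator. [cite: Protas2026, eq. (49)] -/
theorem pow_mul_le_pow_of_hasDerivWithinAt_le_pow_succ {f f' : ℝ → ℝ} {a b A : ℝ} {n : ℕ}
    (hn : 0 < n) (hab : a < b)
    (hf : ∀ t ∈ Icc a b, HasDerivWithinAt f (f' t) (Icc a b) t)
    (hpos : ∀ t ∈ Icc a b, 0 < f t) (hle : ∀ t ∈ Icc a b, f' t ≤ A * f t ^ (n + 1)) {t : ℝ}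
    (ht : t ∈ Icc a b) :
    f t ^ n * (1 - n * A * f a ^ n * (t - a)) ≤ f a ^ n := by
  obtain ⟨m, rfl⟩ : ∃ m, n = m + 1 := ⟨n - 1, (Nat.succ_pred_eq_of_pos hn).symm⟩
  have ha : a ∈ Icc a b := left_mem_Icc.2 hab.le
  -- `g = f⁻ⁿ + n A (· − a)` and its derivative within `[a, b]`
  set g : ℝ → ℝ := fun s => (f s ^ (m + 1))⁻¹ + (m + 1) * A * (s - a) with hg
  have hg' : ∀ s ∈ Icc a b, HasDerivWithinAt g
      (-((m + 1) * f s ^ m * f' s) / (f s ^ (m + 1)) ^ 2 + (m + 1) * A) (Icc a b) s := by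
    intro s hs
    have h1 : HasDerivWithinAt (fun r => f r ^ (m + 1)) ((m + 1) * f s ^ m * f' s)
        (Icc a b) s :=
      ((hf s hs).pow (m + 1)).congr_deriv (by push_cast; simp)
    have h2 : HasDerivWithinAt (fun r => (f r ^ (m + 1))⁻¹)
        (-((m + 1) * f s ^ m * f' s) / (f s ^ (m + 1)) ^ 2) (Icc a b) s :=
      h1.inv (pow_ne_zero (m + 1) (hpos s hs).ne')
    have h3 : HasDerivWithinAt (fun r => (m + 1) * A * (r - a)) ((m + 1) * A) (Icc a b) s := by
      simpa using ((hasDerivWithinAt_id s (Icc a b)).sub_const a).const_mul ((m + 1) * A)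
    exact h2.add h3
  -- `g` is nondecreasing on `[a, b]`
  have hmono : MonotoneOn g (Icc a b) := by
    refine monotoneOn_of_hasDerivWithinAt_nonneg (convex_Icc a b)
      (fun s hs => (hg' s hs).continuousWithinAt)
      (fun s hs => (hg' s (interior_subset hs)).mono interior_subset) fun s hs => ?_
    rw [interior_Icc] at hs
    have hs' : s ∈ Icc a b := Ioo_subset_Icc_self hs
    have hfs : 0 < f s := hpos s hs'
    have hm1 : (0 : ℝ) < m + 1 := by positivity
    have hprod : (m + 1) * f s ^ m * f' s ≤ (m + 1) * f s ^ m * (A * f s ^ (m + 1 + 1)) :=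
      mul_le_mul_of_nonneg_left (hle s hs') (by positivity)
    have e : (m + 1) * f s ^ m * (A * f s ^ (m + 1 + 1)) = (m + 1) * A * (f s ^ (m + 1)) ^ 2 := by
      ring
    have hdiv : (m + 1) * f s ^ m * f' s / (f s ^ (m + 1)) ^ 2 ≤ (m + 1) * A := by
      rw [div_le_iff₀ (by positivity)]
      linarith [hprod, e]
    have hneg : -((m + 1) * f s ^ m * f' s) / (f s ^ (m + 1)) ^ 2 =
        -((m + 1) * f s ^ m * f' s / (f s ^ (m + 1)) ^ 2) :=
      neg_div _ _
    linarith [hneg]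
  -- compare the endpoints
  have hcmp : g a ≤ g t := hmono ha ht ht.1
  simp only [hg, sub_self, mul_zero, add_zero] at hcmp
  have hfa : 0 < f a ^ (m + 1) := pow_pos (hpos a ha) _
  have hft : 0 < f t ^ (m + 1) := pow_pos (hpos t ht) _
  -- clear denominators: multiply `hcmp` by `f(a)ⁿ f(t)ⁿ > 0`
  have h3 := mul_le_mul_of_nonneg_right hcmp (le_of_lt (mul_pos hfa hft))
  have e1 : (f a ^ (m + 1))⁻¹ * (f a ^ (m + 1) * f t ^ (m + 1)) = f t ^ (m + 1) := by
    field_simp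
  have e2 : ((f t ^ (m + 1))⁻¹ + (m + 1) * A * (t - a)) * (f a ^ (m + 1) * f t ^ (m + 1)) =
      f a ^ (m + 1) + (m + 1) * A * (t - a) * (f a ^ (m + 1) * f t ^ (m + 1)) := by
    field_simp
  rw [e1, e2] at h3
  push_cast
  nlinarith [h3]

/-- **Majorant form.** Under the hypotheses of
`pow_mul_le_pow_of_hasDerivWithinAt_le_pow_succ` and while `n A f(a)ⁿ (t − a) < 1`:
`f(t)ⁿ ≤ f(a)ⁿ / (1 − n A f(a)ⁿ (t − a))`, i.e. `f(t) ≤ f(a) (1 − n A f(a)ⁿ (t − a))^{-1/n}`, finite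
before `t₀ = a + 1/(n A f(a)ⁿ)` (for `n = 2`, `A = C_LD`: the Lu–Doering majorant
`ℰ₀/√(1 − 2 C_LD ℰ₀² t)` of Ayala–Protas 2017, (2.8); for `n = 2q/(q−3)`: the `n`-th power of
Protas 2026 essay, eq. (49)). [cite: Protas2026, eq. (49)] -/
theorem pow_le_pow_div_of_hasDerivWithinAt_le_pow_succ {f f' : ℝ → ℝ} {a b A : ℝ} {n : ℕ}
    (hn : 0 < n) (hab : a < b)
    (hf : ∀ t ∈ Icc a b, HasDerivWithinAt f (f' t) (Icc a b) t)
    (hpos : ∀ t ∈ Icc a b, 0 < f t) (hle : ∀ t ∈ Icc a b, f' t ≤ A * f t ^ (n + 1)) {t : ℝ}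
    (ht : t ∈ Icc a b) (hsmall : n * A * f a ^ n * (t - a) < 1) :
    f t ^ n ≤ f a ^ n / (1 - n * A * f a ^ n * (t - a)) := by
  rw [le_div_iff₀ (by linarith)]
  exact pow_mul_le_pow_of_hasDerivWithinAt_le_pow_succ hn hab hf hpos hle ht

/-- **Backward integration of `y' ≤ A yⁿ⁺¹` from a blow-up time (necessary rate).** Let `0 < n`,
`a < T`, `f > 0` on `[a, T)` with one-sided derivatives `f'` within every `[a, b]`, `a < b < T`,
satisfying `f' ≤ A fⁿ⁺¹` on `[a, T)`. If `f` is unbounded on `[a, T)` then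
`1 ≤ n A f(a)ⁿ (T − a)`, i.e. `f(a) ≥ (n A (T − a))^{-1/n}` and `T − a ≥ 1/(n A f(a)ⁿ)`
(otherwise the majorant stays finite up to `T` and bounds `f`). For `n = 2` this is
`ExtremeGrowthBlowupRate.one_le_of_not_bddAbove_of_hasDerivWithinAt_le_cube` (the enstrophy form
of Leray's 1934 rate); for `n = 2q/(q−3)` it is Leray's `‖u(t)‖_{L^q} ≥ c (T* − t)^{-(q−3)/(2q)}`
(Robinson–Rodrigo–Sadowski 2016, (11.18) via Exercises 11.6–11.7; Protas 2026 essay, (50)); the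
general statement is their Exercise 11.6 with `θ = n + 1` and `κ^{-n} = n c`.
[cite: RobinsonRodrigoSadowskiCUP2016, Exercise 11.6] -/
theorem one_le_of_not_bddAbove_of_hasDerivWithinAt_le_pow_succ {f f' : ℝ → ℝ} {a T A : ℝ}
    {n : ℕ} (hn : 0 < n) (haT : a < T)
    (hf : ∀ b, a < b → b < T → ∀ t ∈ Icc a b, HasDerivWithinAt f (f' t) (Icc a b) t)
    (hpos : ∀ t ∈ Ico a T, 0 < f t) (hle : ∀ t ∈ Ico a T, f' t ≤ A * f t ^ (n + 1))
    (hunb : ¬ BddAbove (f '' Ico a T)) :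
    1 ≤ n * A * f a ^ n * (T - a) := by
  by_contra hlt
  have hlt : n * A * f a ^ n * (T - a) < 1 := lt_of_not_ge hlt
  apply hunb
  have ha : a ∈ Ico a T := left_mem_Ico.2 haT
  have hfa : 0 < f a := hpos a ha
  have hfan : 0 < f a ^ n := pow_pos hfa n
  set c : ℝ := n * A * f a ^ n with hc
  set D : ℝ := 1 - c * (T - a) with hD
  have hD0 : 0 < D := by rw [hD]; linarith
  set m : ℝ := min 1 D with hm
  have hm0 : 0 < m := lt_min one_pos hD0
  have hm1 : m ≤ 1 := min_le_left _ _
  refine ⟨max 1 (f a ^ n / m), ?_⟩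
  rintro y ⟨s, hs, rfl⟩
  -- the affine function `1 − c (s − a)` stays above `m` on `[a, T)`
  have hEs : m ≤ 1 - c * (s - a) := by
    rcases le_or_gt 0 c with hc0 | hc0
    · have : c * (s - a) ≤ c * (T - a) := mul_le_mul_of_nonneg_left (by linarith [hs.2]) hc0
      calc m ≤ D := min_le_right _ _
        _ ≤ 1 - c * (s - a) := by rw [hD]; linarith
    · have : c * (s - a) ≤ 0 := mul_nonpos_of_nonpos_of_nonneg hc0.le (by linarith [hs.1])
      calc m ≤ 1 := hm1
        _ ≤ 1 - c * (s - a) := by linarith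
  -- `f(s)ⁿ ≤ f(a)ⁿ / m`
  have hpow : f s ^ n ≤ f a ^ n / m := by
    rw [le_div_iff₀ hm0]
    rcases eq_or_lt_of_le hs.1 with h | has
    · subst h
      nlinarith [hfan, hm1, hm0]
    · have key := pow_mul_le_pow_of_hasDerivWithinAt_le_pow_succ hn has (hf s has hs.2)
        (fun t ht => hpos t ⟨ht.1, lt_of_le_of_lt ht.2 hs.2⟩)
        (fun t ht => hle t ⟨ht.1, lt_of_le_of_lt ht.2 hs.2⟩) (right_mem_Icc.2 has.le)
      have hfsn : 0 < f s ^ n := pow_pos (hpos s hs) n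
      have h1 : f s ^ n * m ≤ f s ^ n * (1 - c * (s - a)) :=
        mul_le_mul_of_nonneg_left hEs hfsn.le
      rw [hc] at h1
      linarith [key, h1]
  -- hence `f(s) ≤ max 1 (f(a)ⁿ / m)`
  rcases le_or_gt (f s) 1 with h1 | h1
  · exact h1.trans (le_max_left _ _)
  · have hle1 : f s ≤ f s ^ n := by
      calc f s = f s ^ 1 := (pow_one _).symm
        _ ≤ f s ^ n := pow_le_pow_right₀ h1.le hn
    exact (hle1.trans hpow).trans (le_max_right _ _)

/-- **Blow-up form.** Under the hypotheses of
`one_le_of_not_bddAbove_of_hasDerivWithinAt_le_pow_succ` with unboundedness replaced by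
divergence `f(t) → ∞` as `t ↑ T` (the printed hypothesis "`X(t) → ∞` as `t → T`"):
`1 ≤ n A f(a)ⁿ (T − a)`, i.e. `f(a) ≥ (n A (T − a))^{-1/n}` — Robinson–Rodrigo–Sadowski's
`X(t) ≥ κ (T − t)^{-1/(θ−1)}` with `θ = n + 1`, `κ^{-n} = n c`.
[cite: RobinsonRodrigoSadowskiCUP2016, Exercise 11.6] -/
theorem one_le_of_tendsto_atTop_of_hasDerivWithinAt_le_pow_succ {f f' : ℝ → ℝ} {a T A : ℝ}
    {n : ℕ} (hn : 0 < n) (haT : a < T)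
    (hf : ∀ b, a < b → b < T → ∀ t ∈ Icc a b, HasDerivWithinAt f (f' t) (Icc a b) t)
    (hpos : ∀ t ∈ Ico a T, 0 < f t) (hle : ∀ t ∈ Ico a T, f' t ≤ A * f t ^ (n + 1))
    (hlim : Tendsto f (𝓝[<] T) atTop) :
    1 ≤ n * A * f a ^ n * (T - a) := by
  refine one_le_of_not_bddAbove_of_hasDerivWithinAt_le_pow_succ hn haT hf hpos hle ?_
  rintro ⟨M, hM⟩
  have h1 : ∀ᶠ s in 𝓝[<] T, M + 1 ≤ f s := hlim.eventually (eventually_ge_atTop (M + 1))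
  have h2 : ∀ᶠ s in 𝓝[<] T, s ∈ Ico a T := Ico_mem_nhdsLT haT
  obtain ⟨s, hs1, hs2⟩ := (h1.and h2).exists
  have : f s ≤ M := hM ⟨s, hs2, rfl⟩
  linarith

/-- Consistency with the `n = 2` file: the cubic hypothesis `f' ≤ A f³` of
`ExtremeGrowthBounds.le_div_sqrt_of_hasDerivWithinAt_le_cube` is the case `n = 2`, and the
root-free conclusion reads `f(t)² (1 − 2 A f(a)² (t − a)) ≤ f(a)²` — the square of
Ayala–Protas 2017, eq. (2.8) (`A = C_LD = 27/(8π⁴ν³)`), cleared of the root.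
[cite: AyalaProtas2017, eq. (2.8)] -/
theorem sq_mul_le_sq_of_hasDerivWithinAt_le_cube {f f' : ℝ → ℝ} {a b A : ℝ} (hab : a < b)
    (hf : ∀ t ∈ Icc a b, HasDerivWithinAt f (f' t) (Icc a b) t)
    (hpos : ∀ t ∈ Icc a b, 0 < f t) (hle : ∀ t ∈ Icc a b, f' t ≤ A * f t ^ 3) {t : ℝ}
    (ht : t ∈ Icc a b) :
    f t ^ 2 * (1 - 2 * A * f a ^ 2 * (t - a)) ≤ f a ^ 2 := by
  have h := pow_mul_le_pow_of_hasDerivWithinAt_le_pow_succ (n := 2) two_pos hab hf hpos hle ht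
  push_cast at h
  exact h

end Comparison

end Literature.Analysis.FluidPDE

end
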